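/-
  CuspidalDescentF1Certificate.lean — crux workfile for stmt-BirchSwinnertonDyer-19945
  (`EllipticUnitValueSevenOfGZK`, route K7r `RamifiedSevenEllipticUnits`), crux idea
  `cuspidal-descent-kolyvagin-nonvanishing` (REV 1, g24), author price F1 (the SIGN HINGE), g25.

  NOTHING HERE PROVES A SUMMIT STATEMENT OR A THESES DECL.  This file is a kernel-checked
  certificate of the elementary arithmetic behind F1:

  Let `p(x) = x³ + x² − 2x − 1` (the minimal polynomial of `2cos(2π/7) = ζ₇ + ζ₇⁻¹`, i.e. of a
  generator of `ℚ(ζ₇)⁺`) and `q(a) = a² + a + 2` (the minimal polynomial of the Gauss period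
  `α = ζ₇ + ζ₇² + ζ₇⁴ = (−1 + √−7)/2`).  Over ANY field `K` with `(7 : K) ≠ 0`, for any root `t` of `p`
  and any root `α` of `q`:

  * (49a1 = X₀(49), `[1,−1,0,−2,−1]`)  `T := (t, α·t)` is a nonsingular point of ORDER EXACTLY 7
    (`addOrderOf_T`), with `2T = (s t, α·s t)`, `3T = (r t, ᾱ·r t)`, `4T = (r t, α·r t)`, `−T = (t, ᾱ·t)`
    where `s x = −x² − x + 1`, `r x = x² − 2` are the two non-trivial Galois conjugations of the roots of
    `p` (`root_s`, `s_s`, `s_r`: `s` permutes the roots 3-cyclically) and `ᾱ = −1 − α` is the conjugate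
    root of `q`.  Hence the subgroup `⟨T⟩` is exactly {O} ∪ {points whose x-coordinate is a root of p}:
    it is Galois-stable, i.e. it is the kernel `E[𝔭]` (𝔭 = (√−7)) of the rational 7-isogeny
    49a1 → 49a3, and `p` is its kernel polynomial.
    SIGN: in `K = ℚ(ζ₇) ⊂ ℂ` complex conjugation fixes `t` and maps `α ↦ ᾱ`, so it maps `T ↦ (t, ᾱt) = −T`
    (`neg_T`): conjugation acts by −1 on E[𝔭], the character ψ of E[𝔭] is ODD.  Finer: σ₃ (ζ₇ ↦ ζ₇³)
    maps `t ↦ t³ − 3t = s t` (`frob_three`) and `α ↦ ᾱ` (3 is inert in ℚ(√−7)), so σ₃(T) = (s t, ᾱ s t)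
    = −2T = 5T, i.e. ψ(3) = 5 = 3⁵ (mod 7): ψ = ω⁵ (3 generates (ℤ/7)ˣ).
    Independently of the group law: for a root `t`, `4t³ + b₂t² + 2b₄t + b₆ = ((2α+1)t)² = −7t²`
    (`two_alpha_add_one_sq`, `psi_two_sq`), which is negative for real `t ≠ 0` — the y-coordinates over a
    real root are non-real.
  * (49a3, `[1,−1,0,−107,552]`, the (−7)-twist / 7-isogenous partner)  `P := (2 − 7t, −1 + 28t)` is a
    nonsingular point of ORDER EXACTLY 7 (`addOrderOf_P`) with coordinates in `ℚ(t) = ℚ(ζ₇)⁺` (REAL),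
    `2P = (−5 + 7t + 7t², 27 − 28t − 28t²) = (2 − 7·s t, −1 + 28·s t) = σ₃(P)`, `3P = (16 − 7t², 41 − 21t²)`,
    `4P = (16 − 7t², −57 + 28t²)`; so `⟨P⟩` is Galois-stable (= the kernel of the dual isogeny
    49a3 → 49a1), all its points are real: conjugation acts TRIVIALLY, its character ψ′ is EVEN, and
    σ₃(P) = 2P gives ψ′(3) = 2 = 3²: ψ′ = ω².  (Check: ψψ′ = ω⁷ = ω = det.)

  Consequence used by the card (§ sign hinge, Case A): for D < 0 the kernel of the 7-isogeny of
  E_D = 49a1^(D) is 𝔽₇(ω⁵χ_D), EVEN; the quotient is 𝔽₇(ω²χ_D) = μ₇ ⊗ ϑ with ϑ = ωχ_D even.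

  All proofs are `linear_combination`/`ring` certificates (coefficients found by exact arithmetic in
  ℚ[t,α]/(p,q), folder `num/cert.py`) fed through Mathlib's affine group law
  (`WeierstrassCurve.Affine.Point`).  Mathlib only; no `sorry`, no `native_decide`.
-/
import Mathlib

set_option linter.dupNamespace false

namespace Summit.BirchSwinnertonDyer.BirchSwinnertonDyer.Cruxes.EllipticUnitValueSevenOfGZK.CuspidalDescent.F1

open WeierstrassCurve WeierstrassCurve.Affine

/-- Cremona 49a1 = `X₀(49)`: `[a₁,a₂,a₃,a₄,a₆] = [1,-1,0,-2,-1]`, over any commutative ring. -/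
def X049 (R : Type*) [CommRing R] : Affine R :=
  { a₁ := 1, a₂ := -1, a₃ := 0, a₄ := -2, a₆ := -1 }

/-- Cremona 49a3 (7-isogenous to 49a1, its twist by −7): `[1,-1,0,-107,552]`. -/
def X049c (R : Type*) [CommRing R] : Affine R :=
  { a₁ := 1, a₂ := -1, a₃ := 0, a₄ := -107, a₆ := 552 }

section invariants
variable {R : Type*} [CommRing R]

@[simp] lemma X049_a₁ : (X049 R).a₁ = 1 := rfl
@[simp] lemma X049_a₂ : (X049 R).a₂ = -1 := rfl
@[simp] lemma X049_a₃ : (X049 R).a₃ = 0 := rfl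
@[simp] lemma X049_a₄ : (X049 R).a₄ = -2 := rfl
@[simp] lemma X049_a₆ : (X049 R).a₆ = -1 := rfl
@[simp] lemma X049c_a₁ : (X049c R).a₁ = 1 := rfl
@[simp] lemma X049c_a₂ : (X049c R).a₂ = -1 := rfl
@[simp] lemma X049c_a₃ : (X049c R).a₃ = 0 := rfl
@[simp] lemma X049c_a₄ : (X049c R).a₄ = -107 := rfl
@[simp] lemma X049c_a₆ : (X049c R).a₆ = 552 := rfl

end invariants

/-! ## Ring identities in `ℤ[t, α]/(p(t), q(α))` (any commutative ring) -/
section ringIdentities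
variable {R : Type*} [CommRing R] {t α : R}

/-- A root of `p` is a unit: `t · (t² + t − 2) = 1`. -/
theorem root_unit (ht : t ^ 3 + t ^ 2 - 2 * t - 1 = 0) : t * (t ^ 2 + t - 2) = 1 := by
  linear_combination ht

/-- `s t = −t² − t + 1` is again a root of `p`. -/
theorem root_s (ht : t ^ 3 + t ^ 2 - 2 * t - 1 = 0) :
    (-t ^ 2 - t + 1) ^ 3 + (-t ^ 2 - t + 1) ^ 2 - 2 * (-t ^ 2 - t + 1) - 1 = 0 := by
  linear_combination (-t ^ 3 - 2 * t ^ 2 + t + 1) * ht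

/-- `r t = t² − 2` is again a root of `p`. -/
theorem root_r (ht : t ^ 3 + t ^ 2 - 2 * t - 1 = 0) :
    (t ^ 2 - 2) ^ 3 + (t ^ 2 - 2) ^ 2 - 2 * (t ^ 2 - 2) - 1 = 0 := by
  linear_combination (t ^ 3 - t ^ 2 - 2 * t + 1) * ht

/-- `s (s t) = r t`. -/
theorem s_s (ht : t ^ 3 + t ^ 2 - 2 * t - 1 = 0) :
    -(-t ^ 2 - t + 1) ^ 2 - (-t ^ 2 - t + 1) + 1 = t ^ 2 - 2 := by
  linear_combination (-t - 1) * ht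

/-- `s (r t) = t`: together with `s_s`, `s` is a 3-cycle on the roots of `p`. -/
theorem s_r (ht : t ^ 3 + t ^ 2 - 2 * t - 1 = 0) :
    -(t ^ 2 - 2) ^ 2 - (t ^ 2 - 2) + 1 = t := by
  linear_combination (-t + 1) * ht

/-- Vieta: the three roots `t, s t, r t` sum to `−1` and multiply to `1`. -/
theorem vieta (ht : t ^ 3 + t ^ 2 - 2 * t - 1 = 0) :
    t + (-t ^ 2 - t + 1) + (t ^ 2 - 2) = -1 ∧ t * (-t ^ 2 - t + 1) * (t ^ 2 - 2) = 1 := by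
  constructor
  · ring
  · linear_combination (-t ^ 2 + 1) * ht

/-- Frobenius at 3 / Chebyshev: `t³ − 3t = s t` (σ₃ : ζ ↦ ζ³ maps `ζ+ζ⁻¹ ↦ ζ³+ζ⁻³ = t³ − 3t`). -/
theorem frob_three (ht : t ^ 3 + t ^ 2 - 2 * t - 1 = 0) : t ^ 3 - 3 * t = -t ^ 2 - t + 1 := by
  linear_combination ht

/-- Frobenius at 2: `t² − 2 = r t` is tautological (σ₂ : ζ+ζ⁻¹ ↦ ζ²+ζ⁻² = t² − 2); recorded for reference:
`(t − s t)·(t² + 3t − 3) = 7`, so distinct roots differ by a divisor of 7. -/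
theorem root_diff_dvd_seven (ht : t ^ 3 + t ^ 2 - 2 * t - 1 = 0) :
    (t - (-t ^ 2 - t + 1)) * (t ^ 2 + 3 * t - 3) = 7 := by
  linear_combination (t + 4) * ht

/-- The conjugate root of `q`: `ᾱ = −1 − α`. -/
theorem conj_root (hα : α ^ 2 + α + 2 = 0) : (-1 - α) ^ 2 + (-1 - α) + 2 = 0 := by
  linear_combination hα

/-- `(2α + 1)² = −7`, i.e. `2α + 1 = ±√−7`. -/
theorem two_alpha_add_one_sq (hα : α ^ 2 + α + 2 = 0) : (2 * α + 1) ^ 2 = -7 := by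
  linear_combination 4 * hα

/-- Non-reality over a real root: for 49a1, `4x³ + b₂x² + 2b₄x + b₆ = 4x³ − 3x² − 8x − 4` equals `−7t²`
at a root `t` of `p` (this quantity is `(2y + a₁x + a₃)²` for a point `(x, y)`, so `y ∉ ℝ` when `t ∈ ℝˣ`). -/
theorem psi_two_sq (ht : t ^ 3 + t ^ 2 - 2 * t - 1 = 0) :
    4 * t ^ 3 - 3 * t ^ 2 - 8 * t - 4 = -7 * t ^ 2 := by
  linear_combination 4 * ht

/-- Reality for 49a3: the same quantity (`b₂ = −3, b₄ = −214, b₆ = 2208`) at `x = 2 − 7t` is the square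
`(49 t)²`. -/
theorem psi_two_sq_c (ht : t ^ 3 + t ^ 2 - 2 * t - 1 = 0) :
    4 * (2 - 7 * t) ^ 3 - 3 * (2 - 7 * t) ^ 2 + 2 * (-214) * (2 - 7 * t) + 2208 = (49 * t) ^ 2 := by
  linear_combination (-1372) * ht

end ringIdentities

/-! ## The group law: `T = (t, αt)` on 49a1 has order 7 -/
section groupLaw49a1
variable {K : Type*} [Field K] [DecidableEq K] {t x α : K}

omit [DecidableEq K] in
theorem seven_ne_zero_aux (hx : x ^ 3 + x ^ 2 - 2 * x - 1 = 0) (hα : α ^ 2 + α + 2 = 0)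
    (h7 : (7 : K) ≠ 0) : (2 * α + 1) * x ≠ 0 := by
  intro h
  apply h7
  linear_combination (4 * x * (x ^ 2 + x - 2)) * hα - 7 * hx - ((2 * α + 1) * (x ^ 2 + x - 2)) * h

omit [DecidableEq K] in
/-- `(x, αx)` lies on 49a1 for every root `x` of `p` and root `α` of `q`. -/
theorem equation_root (hx : x ^ 3 + x ^ 2 - 2 * x - 1 = 0) (hα : α ^ 2 + α + 2 = 0) :
    (X049 K).Equation x (α * x) := by
  rw [equation_iff']
  simp only [X049_a₁, X049_a₂, X049_a₃, X049_a₄, X049_a₆]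
  linear_combination (-1 : K) * hx + x ^ 2 * hα

omit [DecidableEq K] in
/-- … and is nonsingular when `7 ≠ 0` in `K`. -/
theorem nonsingular_root (hx : x ^ 3 + x ^ 2 - 2 * x - 1 = 0) (hα : α ^ 2 + α + 2 = 0)
    (h7 : (7 : K) ≠ 0) : (X049 K).Nonsingular x (α * x) := by
  rw [nonsingular_iff]
  refine ⟨equation_root hx hα, Or.inr ?_⟩
  simp only [X049_a₁, X049_a₃]
  intro h
  apply seven_ne_zero_aux hx hα h7
  linear_combination h

omit [DecidableEq K] in
theorem Y_ne_negY_root (hx : x ^ 3 + x ^ 2 - 2 * x - 1 = 0) (hα : α ^ 2 + α + 2 = 0)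
    (h7 : (7 : K) ≠ 0) : α * x ≠ (X049 K).negY x (α * x) := by
  simp only [negY, X049_a₁, X049_a₃]
  intro h
  apply seven_ne_zero_aux hx hα h7
  linear_combination h

/-- DOUBLING: `2·(x, αx) = (s x, α·s x)` for every root `x` of `p`. -/
theorem two_mul_root (hx : x ^ 3 + x ^ 2 - 2 * x - 1 = 0) (hα : α ^ 2 + α + 2 = 0)
    (h7 : (7 : K) ≠ 0) :
    (Point.some _ _ (nonsingular_root hx hα h7) : (X049 K).Point) + Point.some _ _ (nonsingular_root hx hα h7)
      = Point.some _ _ (nonsingular_root (root_s hx) hα h7) := by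
  have hd : (2 * α + 1) * x ≠ 0 := seven_ne_zero_aux hx hα h7
  have hy := Y_ne_negY_root hx hα h7
  -- slope · denominator = numerator
  have hL : (X049 K).slope x x (α * x) (α * x) * ((2 * α + 1) * x) = 3 * x ^ 2 - 2 * x - 2 - α * x := by
    have hden : α * x - (X049 K).negY x (α * x) = (2 * α + 1) * x := by
      simp only [negY, X049_a₁, X049_a₃]; ring
    have hnum : 3 * x ^ 2 + 2 * (X049 K).a₂ * x + (X049 K).a₄ - (X049 K).a₁ * (α * x)
        = 3 * x ^ 2 - 2 * x - 2 - α * x := by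
      simp only [X049_a₁, X049_a₂, X049_a₄]; ring
    rw [slope_of_Y_ne rfl hy, hden, hnum]
    exact div_mul_cancel₀ _ hd
  rw [Point.add_self_of_Y_ne hy, Point.some.injEq]
  have hX : (X049 K).addX x x ((X049 K).slope x x (α * x) (α * x)) = -x ^ 2 - x + 1 := by
    simp only [addX, X049_a₁, X049_a₂]
    have key : ((2 * α + 1) * x) ^ 2 * ((X049 K).slope x x (α * x) (α * x) ^ 2
          + 1 * (X049 K).slope x x (α * x) (α * x) - (-1) - x - x)
        = ((X049 K).slope x x (α * x) (α * x) * ((2 * α + 1) * x)) ^ 2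
          + ((X049 K).slope x x (α * x) (α * x) * ((2 * α + 1) * x)) * ((2 * α + 1) * x)
          + (1 - 2 * x) * ((2 * α + 1) * x) ^ 2 := by ring
    rw [hL] at key
    have key2 : ((2 * α + 1) * x) ^ 2 * (-x ^ 2 - x + 1)
        = (3 * x ^ 2 - 2 * x - 2 - α * x) ^ 2 + (3 * x ^ 2 - 2 * x - 2 - α * x) * ((2 * α + 1) * x)
          + (1 - 2 * x) * ((2 * α + 1) * x) ^ 2 := by
      linear_combination (-2 * x + 4) * hx + (-4 * x ^ 4 + 4 * x ^ 3 + x ^ 2) * hα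
    have := mul_left_cancel₀ (pow_ne_zero 2 hd) (key.trans key2.symm)
    linear_combination this
  refine ⟨hX, ?_⟩
  simp only [addY, negAddY]
  rw [hX]
  simp only [negY, X049_a₁, X049_a₃]
  have key3 : ((2 * α + 1) * x) * (-((X049 K).slope x x (α * x) (α * x) * (-x ^ 2 - x + 1 - x) + α * x)
        - 1 * (-x ^ 2 - x + 1) - 0)
      = -(((X049 K).slope x x (α * x) (α * x) * ((2 * α + 1) * x)) * (-x ^ 2 - x + 1 - x))
        - ((2 * α + 1) * x) * (α * x) - ((2 * α + 1) * x) * (-x ^ 2 - x + 1) := by ring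
  rw [hL] at key3
  have key4 : ((2 * α + 1) * x) * (α * (-x ^ 2 - x + 1))
      = -((3 * x ^ 2 - 2 * x - 2 - α * x) * (-x ^ 2 - x + 1 - x))
        - ((2 * α + 1) * x) * (α * x) - ((2 * α + 1) * x) * (-x ^ 2 - x + 1) := by
    linear_combination (-3 * x + 2) * hx + (-2 * x ^ 3 + 2 * x) * hα
  have := mul_left_cancel₀ hd (key3.trans key4.symm)
  linear_combination this

/-- CHORD: `T + 2T = 3T = (r t, ᾱ·r t)` (the chord through `T` and `2T` is the line `y = αx`). -/
theorem three_T (ht : t ^ 3 + t ^ 2 - 2 * t - 1 = 0) (hα : α ^ 2 + α + 2 = 0) (h7 : (7 : K) ≠ 0) :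
    (Point.some _ _ (nonsingular_root ht hα h7) : (X049 K).Point)
        + Point.some _ _ (nonsingular_root (root_s ht) hα h7)
      = Point.some _ _ (nonsingular_root (root_r ht) (conj_root hα) h7) := by
  have hx : t ≠ -t ^ 2 - t + 1 := by
    intro h
    apply h7
    linear_combination (t ^ 2 + 3 * t - 3) * h - (t + 4) * ht
  rw [Point.add_of_X_ne hx, Point.some.injEq]
  have hL : (X049 K).slope t (-t ^ 2 - t + 1) (α * t) (α * (-t ^ 2 - t + 1)) = α := by
    rw [slope_of_X_ne hx, div_eq_iff (sub_ne_zero.mpr hx)]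
    ring
  rw [hL]
  have hX : (X049 K).addX t (-t ^ 2 - t + 1) α = t ^ 2 - 2 := by
    simp only [addX, X049_a₁, X049_a₂]
    linear_combination hα
  refine ⟨hX, ?_⟩
  simp only [addY, negAddY]
  rw [hX]
  simp only [negY, X049_a₁, X049_a₃]
  ring

/-- `2T + 2T = 4T = (r t, α·r t)` (doubling at the root `s t`, then `s (s t) = r t`). -/
theorem four_T (ht : t ^ 3 + t ^ 2 - 2 * t - 1 = 0) (hα : α ^ 2 + α + 2 = 0) (h7 : (7 : K) ≠ 0) :
    (Point.some _ _ (nonsingular_root (root_s ht) hα h7) : (X049 K).Point)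
        + Point.some _ _ (nonsingular_root (root_s ht) hα h7)
      = Point.some _ _ (nonsingular_root (root_r ht) hα h7) := by
  rw [two_mul_root (root_s ht) hα h7, Point.some.injEq]
  constructor
  · linear_combination (-t - 1) * ht
  · linear_combination (α * (-t - 1)) * ht

omit [DecidableEq K] in
/-- `3T = −4T`. -/
theorem three_T_eq_neg_four_T (ht : t ^ 3 + t ^ 2 - 2 * t - 1 = 0) (hα : α ^ 2 + α + 2 = 0)
    (h7 : (7 : K) ≠ 0) :
    (Point.some _ _ (nonsingular_root (root_r ht) (conj_root hα) h7) : (X049 K).Point)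
      = -Point.some _ _ (nonsingular_root (root_r ht) hα h7) := by
  rw [Point.neg_some, Point.some.injEq]
  refine ⟨rfl, ?_⟩
  simp only [negY, X049_a₁, X049_a₃]
  ring

omit [DecidableEq K] in
/-- NEGATION = CONJUGATION: `−(t, αt) = (t, ᾱt)`. -/
theorem neg_T (ht : t ^ 3 + t ^ 2 - 2 * t - 1 = 0) (hα : α ^ 2 + α + 2 = 0) (h7 : (7 : K) ≠ 0) :
    -(Point.some _ _ (nonsingular_root ht hα h7) : (X049 K).Point)
      = Point.some _ _ (nonsingular_root ht (conj_root hα) h7) := by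
  rw [Point.neg_some, Point.some.injEq]
  refine ⟨rfl, ?_⟩
  simp only [negY, X049_a₁, X049_a₃]
  ring

/-- `7·T = O`. -/
theorem seven_smul_T (ht : t ^ 3 + t ^ 2 - 2 * t - 1 = 0) (hα : α ^ 2 + α + 2 = 0)
    (h7 : (7 : K) ≠ 0) :
    (7 : ℕ) • (Point.some _ _ (nonsingular_root ht hα h7) : (X049 K).Point) = 0 := by
  have e : ∀ P : (X049 K).Point, (7 : ℕ) • P = (P + (P + P)) + ((P + P) + (P + P)) := by
    intro P; abel
  rw [e, two_mul_root ht hα h7, three_T ht hα h7, four_T ht hα h7, three_T_eq_neg_four_T ht hα h7,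
    neg_add_cancel]

/-- `T = (t, αt)` has order exactly 7 on `X₀(49)`. -/
theorem addOrderOf_T (ht : t ^ 3 + t ^ 2 - 2 * t - 1 = 0) (hα : α ^ 2 + α + 2 = 0)
    (h7 : (7 : K) ≠ 0) :
    addOrderOf (Point.some _ _ (nonsingular_root ht hα h7) : (X049 K).Point) = 7 := by
  haveI : Fact (Nat.Prime 7) := ⟨by norm_num⟩
  exact addOrderOf_eq_prime (seven_smul_T ht hα h7) (Point.some_ne_zero _)

end groupLaw49a1

/-! ## The group law: `P = (2 − 7t, −1 + 28t)` on 49a3 has order 7 (coordinates in `ℚ(t)`, real) -/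
section groupLaw49a3
variable {K : Type*} [Field K] [DecidableEq K] {t : K}

omit [DecidableEq K] in
private theorem ns_of_eq {u w : K} (he : (X049c K).Equation u w) (hd : 2 * w + u ≠ 0) :
    (X049c K).Nonsingular u w := by
  rw [nonsingular_iff]
  refine ⟨he, Or.inr ?_⟩
  simp only [X049c_a₁, X049c_a₃]
  intro h
  apply hd
  linear_combination h

omit [DecidableEq K] in
theorem nonsingular_P (ht : t ^ 3 + t ^ 2 - 2 * t - 1 = 0) (h7 : (7 : K) ≠ 0) :
    (X049c K).Nonsingular (2 - 7 * t) (-1 + 28 * t) := by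
  refine ns_of_eq ?_ ?_
  · rw [equation_iff']
    simp only [X049c_a₁, X049c_a₂, X049c_a₃, X049c_a₄, X049c_a₆]
    linear_combination (343 : K) * ht
  · intro h
    apply mul_ne_zero h7 h7
    linear_combination (t ^ 2 + t - 2) * h - 49 * ht

omit [DecidableEq K] in
theorem nonsingular_twoP (ht : t ^ 3 + t ^ 2 - 2 * t - 1 = 0) (h7 : (7 : K) ≠ 0) :
    (X049c K).Nonsingular (-5 + 7 * t + 7 * t ^ 2) (27 - 28 * t - 28 * t ^ 2) := by
  refine ns_of_eq ?_ ?_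
  · rw [equation_iff']
    simp only [X049c_a₁, X049c_a₂, X049c_a₃, X049c_a₄, X049c_a₆]
    linear_combination (-343 * t ^ 3 - 686 * t ^ 2 + 343 * t + 343) * ht
  · intro h
    apply mul_ne_zero h7 h7
    linear_combination (t * (t ^ 2 - 2)) * h - (49 * (1 - t ^ 2)) * ht

omit [DecidableEq K] in
theorem nonsingular_threeP (ht : t ^ 3 + t ^ 2 - 2 * t - 1 = 0) (h7 : (7 : K) ≠ 0) :
    (X049c K).Nonsingular (16 - 7 * t ^ 2) (41 - 21 * t ^ 2) := by
  refine ns_of_eq ?_ ?_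
  · rw [equation_iff']
    simp only [X049c_a₁, X049c_a₂, X049c_a₃, X049c_a₄, X049c_a₆]
    linear_combination (343 * t ^ 3 - 343 * t ^ 2 - 686 * t + 343) * ht
  · intro h
    apply mul_ne_zero h7 h7
    linear_combination (-t * (-t ^ 2 - t + 1)) * h - (49 * (1 - t ^ 2)) * ht

omit [DecidableEq K] in
theorem nonsingular_fourP (ht : t ^ 3 + t ^ 2 - 2 * t - 1 = 0) (h7 : (7 : K) ≠ 0) :
    (X049c K).Nonsingular (16 - 7 * t ^ 2) (-57 + 28 * t ^ 2) := by
  refine ns_of_eq ?_ ?_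
  · rw [equation_iff']
    simp only [X049c_a₁, X049c_a₂, X049c_a₃, X049c_a₄, X049c_a₆]
    linear_combination (343 * t ^ 3 - 343 * t ^ 2 - 686 * t + 343) * ht
  · intro h
    apply mul_ne_zero h7 h7
    linear_combination (t * (-t ^ 2 - t + 1)) * h - (49 * (1 - t ^ 2)) * ht

/-- DOUBLING: `2P = (−5 + 7t + 7t², 27 − 28t − 28t²)` (`= (2 − 7·s t, −1 + 28·s t) = σ₃ P`). -/
theorem two_P (ht : t ^ 3 + t ^ 2 - 2 * t - 1 = 0) (h7 : (7 : K) ≠ 0) :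
    (Point.some _ _ (nonsingular_P ht h7) : (X049c K).Point) + Point.some _ _ (nonsingular_P ht h7)
      = Point.some _ _ (nonsingular_twoP ht h7) := by
  have hd : (49 : K) * t ≠ 0 := by
    intro h
    apply mul_ne_zero h7 h7
    linear_combination (t ^ 2 + t - 2) * h - 49 * ht
  have hy : -1 + 28 * t ≠ (X049c K).negY (2 - 7 * t) (-1 + 28 * t) := by
    simp only [negY, X049c_a₁, X049c_a₃]
    intro h
    apply hd
    linear_combination h
  have hL : (X049c K).slope (2 - 7 * t) (2 - 7 * t) (-1 + 28 * t) (-1 + 28 * t) * (49 * t)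
      = 3 * (2 - 7 * t) ^ 2 - 2 * (2 - 7 * t) - 107 - (-1 + 28 * t) := by
    have hden : -1 + 28 * t - (X049c K).negY (2 - 7 * t) (-1 + 28 * t) = 49 * t := by
      simp only [negY, X049c_a₁, X049c_a₃]; ring
    have hnum : 3 * (2 - 7 * t) ^ 2 + 2 * (X049c K).a₂ * (2 - 7 * t) + (X049c K).a₄
          - (X049c K).a₁ * (-1 + 28 * t)
        = 3 * (2 - 7 * t) ^ 2 - 2 * (2 - 7 * t) - 107 - (-1 + 28 * t) := by
      simp only [X049c_a₁, X049c_a₂, X049c_a₄]; ring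
    rw [slope_of_Y_ne rfl hy, hden, hnum]
    exact div_mul_cancel₀ _ hd
  rw [Point.add_self_of_Y_ne hy, Point.some.injEq]
  have hX : (X049c K).addX (2 - 7 * t) (2 - 7 * t)
      ((X049c K).slope (2 - 7 * t) (2 - 7 * t) (-1 + 28 * t) (-1 + 28 * t)) = -5 + 7 * t + 7 * t ^ 2 := by
    simp only [addX, X049c_a₁, X049c_a₂]
    have key : (49 * t) ^ 2 * ((X049c K).slope (2 - 7 * t) (2 - 7 * t) (-1 + 28 * t) (-1 + 28 * t) ^ 2
          + 1 * (X049c K).slope (2 - 7 * t) (2 - 7 * t) (-1 + 28 * t) (-1 + 28 * t) - (-1)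
          - (2 - 7 * t) - (2 - 7 * t))
        = ((X049c K).slope (2 - 7 * t) (2 - 7 * t) (-1 + 28 * t) (-1 + 28 * t) * (49 * t)) ^ 2
          + ((X049c K).slope (2 - 7 * t) (2 - 7 * t) (-1 + 28 * t) (-1 + 28 * t) * (49 * t)) * (49 * t)
          + (1 - 2 * (2 - 7 * t)) * (49 * t) ^ 2 := by ring
    rw [hL] at key
    have key2 : (49 * t) ^ 2 * (-5 + 7 * t + 7 * t ^ 2)
        = (3 * (2 - 7 * t) ^ 2 - 2 * (2 - 7 * t) - 107 - (-1 + 28 * t)) ^ 2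
          + (3 * (2 - 7 * t) ^ 2 - 2 * (2 - 7 * t) - 107 - (-1 + 28 * t)) * (49 * t)
          + (1 - 2 * (2 - 7 * t)) * (49 * t) ^ 2 := by
      linear_combination (-4802 * t + 9604) * ht
    have := mul_left_cancel₀ (pow_ne_zero 2 hd) (key.trans key2.symm)
    linear_combination this
  refine ⟨hX, ?_⟩
  simp only [addY, negAddY]
  rw [hX]
  simp only [negY, X049c_a₁, X049c_a₃]
  have key3 : (49 * t) * (-((X049c K).slope (2 - 7 * t) (2 - 7 * t) (-1 + 28 * t) (-1 + 28 * t)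
          * (-5 + 7 * t + 7 * t ^ 2 - (2 - 7 * t)) + (-1 + 28 * t)) - 1 * (-5 + 7 * t + 7 * t ^ 2) - 0)
      = -(((X049c K).slope (2 - 7 * t) (2 - 7 * t) (-1 + 28 * t) (-1 + 28 * t) * (49 * t))
          * (-5 + 7 * t + 7 * t ^ 2 - (2 - 7 * t)))
        - (49 * t) * (-1 + 28 * t) - (49 * t) * (-5 + 7 * t + 7 * t ^ 2) := by ring
  rw [hL] at key3
  have key4 : (49 * t) * (27 - 28 * t - 28 * t ^ 2)
      = -((3 * (2 - 7 * t) ^ 2 - 2 * (2 - 7 * t) - 107 - (-1 + 28 * t))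
          * (-5 + 7 * t + 7 * t ^ 2 - (2 - 7 * t)))
        - (49 * t) * (-1 + 28 * t) - (49 * t) * (-5 + 7 * t + 7 * t ^ 2) := by
    linear_combination (1029 * t - 686) * ht
  have := mul_left_cancel₀ hd (key3.trans key4.symm)
  linear_combination this

/-- CHORD: `P + 2P = 3P = (16 − 7t², 41 − 21t²)`; the chord has the RATIONAL slope −4. -/
theorem three_P (ht : t ^ 3 + t ^ 2 - 2 * t - 1 = 0) (h7 : (7 : K) ≠ 0) :
    (Point.some _ _ (nonsingular_P ht h7) : (X049c K).Point) + Point.some _ _ (nonsingular_twoP ht h7)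
      = Point.some _ _ (nonsingular_threeP ht h7) := by
  have hx : (2 - 7 * t) ≠ -5 + 7 * t + 7 * t ^ 2 := by
    intro h
    apply mul_ne_zero h7 h7
    linear_combination (-(t ^ 2 + 3 * t - 3)) * h - (7 * (t + 4)) * ht
  rw [Point.add_of_X_ne hx, Point.some.injEq]
  have hL : (X049c K).slope (2 - 7 * t) (-5 + 7 * t + 7 * t ^ 2) (-1 + 28 * t)
      (27 - 28 * t - 28 * t ^ 2) = -4 := by
    rw [slope_of_X_ne hx, div_eq_iff (sub_ne_zero.mpr hx)]
    ring
  rw [hL]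
  have hX : (X049c K).addX (2 - 7 * t) (-5 + 7 * t + 7 * t ^ 2) (-4) = 16 - 7 * t ^ 2 := by
    simp only [addX, X049c_a₁, X049c_a₂]
    ring
  refine ⟨hX, ?_⟩
  simp only [addY, negAddY]
  rw [hX]
  simp only [negY, X049c_a₁, X049c_a₃]
  ring

/-- DOUBLING: `2P + 2P = 4P = (16 − 7t², −57 + 28t²)`. -/
theorem four_P (ht : t ^ 3 + t ^ 2 - 2 * t - 1 = 0) (h7 : (7 : K) ≠ 0) :
    (Point.some _ _ (nonsingular_twoP ht h7) : (X049c K).Point) + Point.some _ _ (nonsingular_twoP ht h7)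
      = Point.some _ _ (nonsingular_fourP ht h7) := by
  -- denominator 2y + x = 49·(s t), a unit times 49
  have hd : (49 : K) * (-t ^ 2 - t + 1) ≠ 0 := by
    intro h
    apply mul_ne_zero h7 h7
    linear_combination (t * (t ^ 2 - 2)) * h - (49 * (1 - t ^ 2)) * ht
  have hy : 27 - 28 * t - 28 * t ^ 2
      ≠ (X049c K).negY (-5 + 7 * t + 7 * t ^ 2) (27 - 28 * t - 28 * t ^ 2) := by
    simp only [negY, X049c_a₁, X049c_a₃]
    intro h
    apply hd
    linear_combination h
  have hL : (X049c K).slope (-5 + 7 * t + 7 * t ^ 2) (-5 + 7 * t + 7 * t ^ 2)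
        (27 - 28 * t - 28 * t ^ 2) (27 - 28 * t - 28 * t ^ 2) * (49 * (-t ^ 2 - t + 1))
      = 3 * (-5 + 7 * t + 7 * t ^ 2) ^ 2 - 2 * (-5 + 7 * t + 7 * t ^ 2) - 107
        - (27 - 28 * t - 28 * t ^ 2) := by
    have hden : 27 - 28 * t - 28 * t ^ 2
          - (X049c K).negY (-5 + 7 * t + 7 * t ^ 2) (27 - 28 * t - 28 * t ^ 2)
        = 49 * (-t ^ 2 - t + 1) := by
      simp only [negY, X049c_a₁, X049c_a₃]; ring
    have hnum : 3 * (-5 + 7 * t + 7 * t ^ 2) ^ 2 + 2 * (X049c K).a₂ * (-5 + 7 * t + 7 * t ^ 2)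
          + (X049c K).a₄ - (X049c K).a₁ * (27 - 28 * t - 28 * t ^ 2)
        = 3 * (-5 + 7 * t + 7 * t ^ 2) ^ 2 - 2 * (-5 + 7 * t + 7 * t ^ 2) - 107
          - (27 - 28 * t - 28 * t ^ 2) := by
      simp only [X049c_a₁, X049c_a₂, X049c_a₄]; ring
    rw [slope_of_Y_ne rfl hy, hden, hnum]
    exact div_mul_cancel₀ _ hd
  rw [Point.add_self_of_Y_ne hy, Point.some.injEq]
  -- abbreviations (purely syntactic lets are avoided on purpose; every term is spelled out)
  have hX : (X049c K).addX (-5 + 7 * t + 7 * t ^ 2) (-5 + 7 * t + 7 * t ^ 2)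
      ((X049c K).slope (-5 + 7 * t + 7 * t ^ 2) (-5 + 7 * t + 7 * t ^ 2)
        (27 - 28 * t - 28 * t ^ 2) (27 - 28 * t - 28 * t ^ 2)) = 16 - 7 * t ^ 2 := by
    simp only [addX, X049c_a₁, X049c_a₂]
    have key : (49 * (-t ^ 2 - t + 1)) ^ 2
          * ((X049c K).slope (-5 + 7 * t + 7 * t ^ 2) (-5 + 7 * t + 7 * t ^ 2)
              (27 - 28 * t - 28 * t ^ 2) (27 - 28 * t - 28 * t ^ 2) ^ 2
            + 1 * (X049c K).slope (-5 + 7 * t + 7 * t ^ 2) (-5 + 7 * t + 7 * t ^ 2)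
              (27 - 28 * t - 28 * t ^ 2) (27 - 28 * t - 28 * t ^ 2) - (-1)
            - (-5 + 7 * t + 7 * t ^ 2) - (-5 + 7 * t + 7 * t ^ 2))
        = ((X049c K).slope (-5 + 7 * t + 7 * t ^ 2) (-5 + 7 * t + 7 * t ^ 2)
              (27 - 28 * t - 28 * t ^ 2) (27 - 28 * t - 28 * t ^ 2) * (49 * (-t ^ 2 - t + 1))) ^ 2
          + ((X049c K).slope (-5 + 7 * t + 7 * t ^ 2) (-5 + 7 * t + 7 * t ^ 2)
              (27 - 28 * t - 28 * t ^ 2) (27 - 28 * t - 28 * t ^ 2) * (49 * (-t ^ 2 - t + 1)))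
            * (49 * (-t ^ 2 - t + 1))
          + (1 - 2 * (-5 + 7 * t + 7 * t ^ 2)) * (49 * (-t ^ 2 - t + 1)) ^ 2 := by ring
    rw [hL] at key
    have key2 : (49 * (-t ^ 2 - t + 1)) ^ 2 * (16 - 7 * t ^ 2)
        = (3 * (-5 + 7 * t + 7 * t ^ 2) ^ 2 - 2 * (-5 + 7 * t + 7 * t ^ 2) - 107
            - (27 - 28 * t - 28 * t ^ 2)) ^ 2
          + (3 * (-5 + 7 * t + 7 * t ^ 2) ^ 2 - 2 * (-5 + 7 * t + 7 * t ^ 2) - 107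
            - (27 - 28 * t - 28 * t ^ 2)) * (49 * (-t ^ 2 - t + 1))
          + (1 - 2 * (-5 + 7 * t + 7 * t ^ 2)) * (49 * (-t ^ 2 - t + 1)) ^ 2 := by
      linear_combination (-21609 * t ^ 5 - 64827 * t ^ 4 - 26411 * t ^ 3 + 50421 * t ^ 2
        + 26411 * t - 12005) * ht
    have := mul_left_cancel₀ (pow_ne_zero 2 hd) (key.trans key2.symm)
    linear_combination this
  refine ⟨hX, ?_⟩
  simp only [addY, negAddY]
  rw [hX]
  simp only [negY, X049c_a₁, X049c_a₃]
  have key3 : (49 * (-t ^ 2 - t + 1))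
        * (-((X049c K).slope (-5 + 7 * t + 7 * t ^ 2) (-5 + 7 * t + 7 * t ^ 2)
              (27 - 28 * t - 28 * t ^ 2) (27 - 28 * t - 28 * t ^ 2)
              * (16 - 7 * t ^ 2 - (-5 + 7 * t + 7 * t ^ 2)) + (27 - 28 * t - 28 * t ^ 2))
            - 1 * (16 - 7 * t ^ 2) - 0)
      = -(((X049c K).slope (-5 + 7 * t + 7 * t ^ 2) (-5 + 7 * t + 7 * t ^ 2)
              (27 - 28 * t - 28 * t ^ 2) (27 - 28 * t - 28 * t ^ 2) * (49 * (-t ^ 2 - t + 1)))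
            * (16 - 7 * t ^ 2 - (-5 + 7 * t + 7 * t ^ 2)))
        - (49 * (-t ^ 2 - t + 1)) * (27 - 28 * t - 28 * t ^ 2)
        - (49 * (-t ^ 2 - t + 1)) * (16 - 7 * t ^ 2) := by ring
  rw [hL] at key3
  have key4 : (49 * (-t ^ 2 - t + 1)) * (-57 + 28 * t ^ 2)
      = -((3 * (-5 + 7 * t + 7 * t ^ 2) ^ 2 - 2 * (-5 + 7 * t + 7 * t ^ 2) - 107
            - (27 - 28 * t - 28 * t ^ 2)) * (16 - 7 * t ^ 2 - (-5 + 7 * t + 7 * t ^ 2)))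
        - (49 * (-t ^ 2 - t + 1)) * (27 - 28 * t - 28 * t ^ 2)
        - (49 * (-t ^ 2 - t + 1)) * (16 - 7 * t ^ 2) := by
    linear_combination (-2058 * t ^ 3 - 3087 * t ^ 2 + 1029 * t + 1715) * ht
  have := mul_left_cancel₀ hd (key3.trans key4.symm)
  linear_combination this

omit [DecidableEq K] in
/-- `3P = −4P`. -/
theorem three_P_eq_neg_four_P (ht : t ^ 3 + t ^ 2 - 2 * t - 1 = 0) (h7 : (7 : K) ≠ 0) :
    (Point.some _ _ (nonsingular_threeP ht h7) : (X049c K).Point)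
      = -Point.some _ _ (nonsingular_fourP ht h7) := by
  rw [Point.neg_some, Point.some.injEq]
  refine ⟨rfl, ?_⟩
  simp only [negY, X049c_a₁, X049c_a₃]
  ring

/-- `7·P = O`. -/
theorem seven_smul_P (ht : t ^ 3 + t ^ 2 - 2 * t - 1 = 0) (h7 : (7 : K) ≠ 0) :
    (7 : ℕ) • (Point.some _ _ (nonsingular_P ht h7) : (X049c K).Point) = 0 := by
  have e : ∀ Q : (X049c K).Point, (7 : ℕ) • Q = (Q + (Q + Q)) + ((Q + Q) + (Q + Q)) := by
    intro Q; abel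
  rw [e, two_P ht h7, three_P ht h7, four_P ht h7, three_P_eq_neg_four_P ht h7, neg_add_cancel]

/-- `P = (2 − 7t, −1 + 28t)` has order exactly 7 on 49a3, over the (real) cubic field `ℚ(t)`. -/
theorem addOrderOf_P (ht : t ^ 3 + t ^ 2 - 2 * t - 1 = 0) (h7 : (7 : K) ≠ 0) :
    addOrderOf (Point.some _ _ (nonsingular_P ht h7) : (X049c K).Point) = 7 := by
  haveI : Fact (Nat.Prime 7) := ⟨by norm_num⟩
  exact addOrderOf_eq_prime (seven_smul_P ht h7) (Point.some_ne_zero _)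

omit [DecidableEq K] in
theorem nonsingular_negP (ht : t ^ 3 + t ^ 2 - 2 * t - 1 = 0) (h7 : (7 : K) ≠ 0) :
    (X049c K).Nonsingular (2 - 7 * t) (-1 - 21 * t) := by
  refine ns_of_eq ?_ ?_
  · rw [equation_iff']
    simp only [X049c_a₁, X049c_a₂, X049c_a₃, X049c_a₄, X049c_a₆]
    linear_combination (343 : K) * ht
  · intro h
    apply mul_ne_zero h7 h7
    linear_combination (-(t ^ 2 + t - 2)) * h - 49 * ht

omit [DecidableEq K] in
/-- `−P = (2 − 7t, −1 − 21t)`: again coordinates in `ℚ(t)` (real) — conjugation acts trivially on `⟨P⟩`. -/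
theorem neg_P (ht : t ^ 3 + t ^ 2 - 2 * t - 1 = 0) (h7 : (7 : K) ≠ 0) :
    -(Point.some _ _ (nonsingular_P ht h7) : (X049c K).Point) = Point.some _ _ (nonsingular_negP ht h7) := by
  rw [Point.neg_some, Point.some.injEq]
  refine ⟨rfl, ?_⟩
  simp only [negY, X049c_a₁, X049c_a₃]
  ring

end groupLaw49a3

end Summit.BirchSwinnertonDyer.BirchSwinnertonDyer.Cruxes.EllipticUnitValueSevenOfGZK.CuspidalDescent.F1
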